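import Literature.Barriers.CriticalPhenomena.TimarCriticalNonunimodular
import HarnessLib

/-!
# Timár 2006, §5: the number of heavy clusters is invariant, hence "infinitely many heavy
# clusters" is a zero–one event — PROVED

Barrier catalogue `Literature/Barriers/CriticalPhenomena/`; a brick of the programme behind the
heavy half of Timár's Cor. 5.7 (`Timar2006_notInfinitelyManyHeavyCriticalClusters`,
`TimarCriticalNonunimodular.lean`). Timár's Thm. 5.5 / Cor. 5.6 are stated under "suppose that
it has infinitely many heavy components" (an almost sure hypothesis: "We do not usually state
explicitly 'with probability 1' in the paper when this is the case", §2), whereas the negation of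
Cor. 5.7's conclusion only gives this event positive probability. The passage is ergodicity of
`P_p` under `Aut(G)` (Lyons–Peres 2016, Prop. 7.3, in the tree as
`Literature.Probability.Percolation.bondPercolation_zero_one_of_autInvariant`) applied to the
invariant event `{there are infinitely many heavy clusters}`; this file supplies the two inputs
and the conclusion:

* `setWeight_image`, `isHeavy_image_iff` — automorphisms rescale weights by a constant
  (`autWeight_map_mul`), so they map heavy vertex sets to heavy vertex sets;
* `le_encard_heavyClusters_iff` — "at least `k` heavy clusters" in terms of `k` pairwise
  disconnected vertices with heavy clusters (as `atLeastInfClusters` for infinite clusters);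
* `infinite_heavyClusters_relabel_iff` (invariance) and `measurableSet_infinite_heavyClusters`;
* `ae_infinite_heavyClusters_of_not_ae` — on an infinite, connected, locally finite,
  quasi-transitive graph, if "not infinitely many heavy clusters" fails to hold almost surely,
  then almost surely there are infinitely many heavy clusters.

## References

* Á. Timár, Ann. Probab. 34 (2006) 2344–2364, §2 ("with probability 1" convention; weights under
  automorphisms), Thm. 5.5, Cor. 5.7. [Timar2006]
* R. Lyons, Y. Peres, *Probability on Trees and Networks*, CUP 2016, Prop. 7.3 and proof of
  Thm. 7.5 (ergodicity of `P_p` under automorphisms). [LyonsPeres2016]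
-/

noncomputable section

namespace Literature.Barriers.CriticalPhenomena

open _root_.MeasureTheory Literature.Probability.LatticeModels Literature.Probability.Percolation
open scoped ENNReal

variable {V : Type*}

/-! ### Heavy sets under automorphisms -/

/-- Open clusters are transported by relabelling along a bijection of the vertices:
`φ C_ω(x) = C_{φω}(φ x)`. [folklore] -/
theorem image_openCluster_relabel (φ : V ≃ V) (ω : BondConfig V) (x : V) :
    (φ : V → V) '' openCluster ω x = openCluster (BondConfig.relabel (sym2Equiv φ) ω) (φ x) := by
  ext z
  constructor
  · rintro ⟨y, hy, rfl⟩
    exact (reachable_relabel_iff φ ω x y).2 hy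
  · intro hz
    refine ⟨φ.symm z, ?_, φ.apply_symm_apply z⟩
    have h : (openGraph (BondConfig.relabel (sym2Equiv φ) ω)).Reachable (φ x) (φ (φ.symm z)) := by
      rw [φ.apply_symm_apply]; exact hz
    exact (reachable_relabel_iff φ ω x _).1 h

/-- Weights transform covariantly: `w_o(γ v) = w_{γ⁻¹ o}(v)`. [cite: Timar2006, §5 (automorphisms act on weights)] -/
theorem autWeight_map (G : SimpleGraph V) (γ : G ≃g G) (o v : V) :
    autWeight G o (γ v) = autWeight G (γ.symm o) v := by
  have h : autWeight G (γ (γ.symm o)) (γ v) = autWeight G (γ.symm o) v := by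
    rw [autWeight, autWeight, encard_stabilizerOrbit_map, encard_stabilizerOrbit_map]
  rwa [γ.apply_symm_apply] at h

/-- The total weight of the image of a vertex set: `W_o(γ C) = W_{γ⁻¹ o}(C)`.
[cite: Timar2006, §2 and §5 (weights under automorphisms)] -/
theorem setWeight_image (G : SimpleGraph V) (γ : G ≃g G) (o : V) (C : Set V) :
    setWeight G o ((γ : V → V) '' C) = setWeight G (γ.symm o) C := by
  rw [setWeight, setWeight, ← Equiv.tsum_eq γ.toEquiv]
  refine tsum_congr fun u => ?_
  show ((γ : V → V) '' C).indicator (autWeight G o) (γ u) = C.indicator (autWeight G (γ.symm o)) u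
  rw [Set.indicator_image γ.injective]
  by_cases hu : u ∈ C
  · rw [Set.indicator_of_mem hu, Set.indicator_of_mem hu]
    exact autWeight_map G γ o u
  · rw [Set.indicator_of_notMem hu, Set.indicator_of_notMem hu]

/-- **Automorphisms map heavy sets to heavy sets** (the weights change by the constant factor of
`autWeight_map_mul`; connected, locally finite `G`). [cite: Timar2006, §5 (any automorphism acts on the weights by multiplying them with a constant)] -/
theorem isHeavy_image_iff (G : SimpleGraph V) [G.LocallyFinite] (hconn : G.Connected) (γ : G ≃g G)
    (o : V) (C : Set V) : IsHeavy G o ((γ : V → V) '' C) ↔ IsHeavy G o C := by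
  rw [IsHeavy, setWeight_image, ← IsHeavy]
  exact isHeavy_iff_of_base G hconn o (γ.symm o) C

/-! ### Counting heavy clusters through vertices -/

/-- The component of `x` is a heavy cluster iff `C(x)` is heavy. [folklore] -/
theorem connectedComponentMk_mem_heavyClusters_iff (G : SimpleGraph V) (o : V) (ω : BondConfig V)
    (x : V) : (openGraph ω).connectedComponentMk x ∈ heavyClusters G o ω ↔
      IsHeavy G o (openCluster ω x) := by
  rw [heavyClusters, Set.mem_setOf_eq, openCluster_eq_supp]

/-- **"At least `k` heavy clusters" in terms of vertices**: `k ≤ |heavy clusters|` iff there are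
`k` vertices with heavy open clusters, no two joined by an open path (cf.
`Literature.Probability.Percolation.mem_atLeastInfClusters_iff` for infinite clusters). [folklore] -/
theorem le_encard_heavyClusters_iff (G : SimpleGraph V) (o : V) (ω : BondConfig V) (k : ℕ) :
    (k : ℕ∞) ≤ (heavyClusters G o ω).encard ↔
      ∃ s : Finset V, s.card = k ∧ (∀ x ∈ s, IsHeavy G o (openCluster ω x)) ∧
        (↑s : Set V).Pairwise fun x y => ¬ (openGraph ω).Reachable x y := by
  classical
  constructor
  · intro hk
    obtain ⟨t, htS, ht⟩ := Set.exists_subset_encard_eq hk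
    have htfin : t.Finite := Set.finite_of_encard_eq_coe ht
    have hrep : ∀ C : (openGraph ω).ConnectedComponent, ∃ v, (openGraph ω).connectedComponentMk v = C :=
      fun C => C.ind fun v => ⟨v, rfl⟩
    choose rep hrep using hrep
    have hrinj : Function.Injective rep := fun C D h => by rw [← hrep C, ← hrep D, h]
    refine ⟨htfin.toFinset.image rep, ?_, ?_, ?_⟩
    · rw [Finset.card_image_of_injective _ hrinj]
      have := htfin.encard_eq_coe_toFinset_card
      rw [ht] at this
      exact_mod_cast this.symm
    · intro x hx
      rw [Finset.mem_image] at hx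
      obtain ⟨C, hC, rfl⟩ := hx
      rw [← connectedComponentMk_mem_heavyClusters_iff, hrep]
      exact htS (htfin.mem_toFinset.1 hC)
    · intro x hx y hy hxy hr
      rw [Finset.coe_image, Set.mem_image] at hx hy
      obtain ⟨C, -, rfl⟩ := hx
      obtain ⟨D, -, rfl⟩ := hy
      apply hxy
      have hCD : C = D := by
        rw [← hrep C, ← hrep D]
        exact SimpleGraph.ConnectedComponent.sound hr
      rw [hCD]
  · rintro ⟨s, hcard, hheavy, hpair⟩
    have hinj : Set.InjOn (fun x => (openGraph ω).connectedComponentMk x) ↑s := by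
      intro x hx y hy hxy
      by_contra hne
      exact hpair hx hy hne (SimpleGraph.ConnectedComponent.exact hxy)
    have hsub : (fun x => (openGraph ω).connectedComponentMk x) '' ↑s ⊆ heavyClusters G o ω := by
      rintro _ ⟨x, hx, rfl⟩
      exact (connectedComponentMk_mem_heavyClusters_iff G o ω x).2 (hheavy x hx)
    calc (k : ℕ∞) = (↑s : Set V).encard := by rw [Set.encard_coe_eq_coe_finsetCard, hcard]
      _ = ((fun x => (openGraph ω).connectedComponentMk x) '' ↑s).encard := (hinj.encard_image).symm
      _ ≤ (heavyClusters G o ω).encard := Set.encard_le_encard hsub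

/-- There are infinitely many heavy clusters iff there are at least `k` for every `k`. [folklore] -/
theorem infinite_heavyClusters_iff (G : SimpleGraph V) (o : V) (ω : BondConfig V) :
    (heavyClusters G o ω).Infinite ↔ ∀ k : ℕ, (k : ℕ∞) ≤ (heavyClusters G o ω).encard := by
  rw [← Set.encard_eq_top_iff, ENat.eq_top_iff_forall_ge]

/-! ### Invariance and measurability of "infinitely many heavy clusters" -/

/-- "At least `k` heavy clusters" is invariant under relabelling by an automorphism.
[cite: Timar2006, §5 (proof of Thm. 5.5: "Note that ω is invariant")] -/
theorem le_encard_heavyClusters_relabel_iff (G : SimpleGraph V) [G.LocallyFinite]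
    (hconn : G.Connected) (γ : G ≃g G) (o : V) (ω : BondConfig V) (k : ℕ) :
    (k : ℕ∞) ≤ (heavyClusters G o (BondConfig.relabel (sym2Equiv γ.toEquiv) ω)).encard ↔
      (k : ℕ∞) ≤ (heavyClusters G o ω).encard := by
  classical
  set φ : V ≃ V := γ.toEquiv with hφ
  rw [le_encard_heavyClusters_iff, le_encard_heavyClusters_iff]
  constructor
  · rintro ⟨s, hcard, hheavy, hpair⟩
    refine ⟨s.image φ.symm, ?_, ?_, ?_⟩
    · rw [Finset.card_image_of_injective _ φ.symm.injective, hcard]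
    · intro x hx
      rw [Finset.mem_image] at hx
      obtain ⟨x', hx', rfl⟩ := hx
      have h := hheavy x' hx'
      rw [show x' = φ (φ.symm x') from (φ.apply_symm_apply x').symm,
        ← image_openCluster_relabel] at h
      change IsHeavy G o ((γ : V → V) '' openCluster ω (φ.symm x')) at h
      rwa [isHeavy_image_iff G hconn γ] at h
    · intro x hx y hy hxy
      rw [Finset.coe_image, Set.mem_image] at hx hy
      obtain ⟨x', hx', rfl⟩ := hx
      obtain ⟨y', hy', rfl⟩ := hy
      rw [← reachable_relabel_iff φ, φ.apply_symm_apply, φ.apply_symm_apply]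
      exact hpair hx' hy' fun h => hxy (by rw [h])
  · rintro ⟨s, hcard, hheavy, hpair⟩
    refine ⟨s.image φ, ?_, ?_, ?_⟩
    · rw [Finset.card_image_of_injective _ φ.injective, hcard]
    · intro x hx
      rw [Finset.mem_image] at hx
      obtain ⟨x', hx', rfl⟩ := hx
      rw [← image_openCluster_relabel]
      change IsHeavy G o ((γ : V → V) '' openCluster ω x')
      rw [isHeavy_image_iff G hconn γ]
      exact hheavy x' hx'
    · intro x hx y hy hxy
      rw [Finset.coe_image, Set.mem_image] at hx hy
      obtain ⟨x', hx', rfl⟩ := hx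
      obtain ⟨y', hy', rfl⟩ := hy
      rw [reachable_relabel_iff φ]
      exact hpair hx' hy' fun h => hxy (by rw [h])

/-- **"Infinitely many heavy clusters" is an invariant event** under `Aut(G)` (connected, locally
finite `G`). [cite: Timar2006, §5 (invariance of the heavy clusters)] -/
theorem infinite_heavyClusters_relabel_iff (G : SimpleGraph V) [G.LocallyFinite]
    (hconn : G.Connected) (γ : G ≃g G) (o : V) (ω : BondConfig V) :
    (heavyClusters G o (BondConfig.relabel (sym2Equiv γ.toEquiv) ω)).Infinite ↔
      (heavyClusters G o ω).Infinite := by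
  rw [infinite_heavyClusters_iff, infinite_heavyClusters_iff]
  exact forall_congr' fun k => le_encard_heavyClusters_relabel_iff G hconn γ o ω k

/-- The total weight of the open cluster of `x` is a measurable function of the configuration
(`V` countable): a `tsum` of the indicators of the events `{x ↔ v}`. [folklore] -/
theorem measurable_setWeight_openCluster [Countable V] (G : SimpleGraph V) (o x : V) :
    Measurable fun ω : BondConfig V => setWeight G o (openCluster ω x) := by
  have h : ∀ ω : BondConfig V, setWeight G o (openCluster ω x) =
      ∑' v, {ω : BondConfig V | (openGraph ω).Reachable x v}.indicator
        (fun _ => autWeight G o v) ω := by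
    intro ω
    rw [setWeight]
    refine tsum_congr fun v => ?_
    by_cases hv : (openGraph ω).Reachable x v
    · rw [Set.indicator_of_mem (show v ∈ openCluster ω x from hv),
        Set.indicator_of_mem (show ω ∈ {ω : BondConfig V | (openGraph ω).Reachable x v} from hv)]
    · rw [Set.indicator_of_notMem (show v ∉ openCluster ω x from hv),
        Set.indicator_of_notMem (show ω ∉ {ω : BondConfig V | (openGraph ω).Reachable x v} from hv)]
  simp_rw [h]
  exact Measurable.tsum fun v =>
    measurable_const.indicator (measurableSet_setOf_reachable x v)

/-- `{C(x) is heavy}` is measurable (`V` countable). [folklore] -/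
theorem measurableSet_isHeavy_openCluster [Countable V] (G : SimpleGraph V) (o x : V) :
    MeasurableSet {ω : BondConfig V | IsHeavy G o (openCluster ω x)} :=
  (measurable_setWeight_openCluster G o x) (measurableSet_singleton ⊤)

/-- `{at least k heavy clusters}` is measurable (`V` countable). [folklore] -/
theorem measurableSet_le_encard_heavyClusters [Countable V] (G : SimpleGraph V) (o : V) (k : ℕ) :
    MeasurableSet {ω : BondConfig V | (k : ℕ∞) ≤ (heavyClusters G o ω).encard} := by
  have h : {ω : BondConfig V | (k : ℕ∞) ≤ (heavyClusters G o ω).encard} =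
      ⋃ s : Finset V, ⋃ (_ : s.card = k),
        ((⋂ x ∈ s, {ω : BondConfig V | IsHeavy G o (openCluster ω x)}) ∩
          ⋂ x ∈ s, ⋂ y ∈ s, {ω : BondConfig V | x ≠ y → ¬ (openGraph ω).Reachable x y}) := by
    ext ω
    simp only [Set.mem_setOf_eq, le_encard_heavyClusters_iff, Set.mem_iUnion, Set.mem_inter_iff,
      Set.mem_iInter, exists_prop, Set.Pairwise, Finset.mem_coe]
  rw [h]
  refine MeasurableSet.iUnion fun s => MeasurableSet.iUnion fun _ => ?_
  refine (s.measurableSet_biInter fun x _ => measurableSet_isHeavy_openCluster G o x).inter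
    (s.measurableSet_biInter fun x _ => s.measurableSet_biInter fun y _ => ?_)
  by_cases hxy : x = y
  · have : {ω : BondConfig V | x ≠ y → ¬ (openGraph ω).Reachable x y} = Set.univ :=
      Set.eq_univ_of_forall fun ω h => absurd hxy h
    rw [this]; exact MeasurableSet.univ
  · have : {ω : BondConfig V | x ≠ y → ¬ (openGraph ω).Reachable x y} =
        {ω : BondConfig V | (openGraph ω).Reachable x y}ᶜ := by
      ext ω; simp [hxy]
    rw [this]; exact (measurableSet_setOf_reachable x y).compl

/-- **`{infinitely many heavy clusters}` is measurable** (`V` countable). [folklore] -/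
theorem measurableSet_infinite_heavyClusters [Countable V] (G : SimpleGraph V) (o : V) :
    MeasurableSet {ω : BondConfig V | (heavyClusters G o ω).Infinite} := by
  have h : {ω : BondConfig V | (heavyClusters G o ω).Infinite} =
      ⋂ k : ℕ, {ω : BondConfig V | (k : ℕ∞) ≤ (heavyClusters G o ω).encard} := by
    ext ω
    simp only [Set.mem_setOf_eq, Set.mem_iInter, infinite_heavyClusters_iff]
  rw [h]
  exact MeasurableSet.iInter fun k => measurableSet_le_encard_heavyClusters G o k

/-! ### The zero–one law for the number of heavy clusters -/

/-- **Zero–one law for "infinitely many heavy clusters"** (Lyons–Peres 2016, Prop. 7.3: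
ergodicity of `P_p` under automorphisms; Timár 2006, §2: events stated "with probability 1"):
on an infinite, connected, locally finite, quasi-transitive graph, under `P_p` the event that
there are infinitely many heavy clusters has probability `0` or `1`; in particular, if it does not
fail almost surely, it holds almost surely.
[cite: LyonsPeres2016, Prop. 7.3 and Thm. 7.5 (proof)] [cite: Timar2006, §2 ("with probability 1") and Thm. 5.5 (hypothesis)] -/
theorem ae_infinite_heavyClusters_of_not_ae [Infinite V] (G : SimpleGraph V) [G.LocallyFinite]
    (hconn : G.Connected) (hqt : IsQuasiTransitive G) (o : V) (p : unitInterval)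
    (h : ¬ ∀ᵐ ω ∂(bondPercolation G p), ¬ (heavyClusters G o ω).Infinite) :
    ∀ᵐ ω ∂(bondPercolation G p), (heavyClusters G o ω).Infinite := by
  haveI : Countable V := countable_of_connected_of_locallyFinite G hconn o
  set A : Set (BondConfig V) := {ω | (heavyClusters G o ω).Infinite} with hA
  have hAm : MeasurableSet A := measurableSet_infinite_heavyClusters G o
  have h01 := bondPercolation_zero_one_of_autInvariant G p
    (fun U hU => hqt.exists_iso_disjoint_image hconn U hU) hAm
    fun γ => by
      ext ω
      simp only [hA, Set.mem_preimage, Set.mem_setOf_eq]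
      exact infinite_heavyClusters_relabel_iff G hconn γ o ω
  rcases h01 with h0 | h1
  · exact absurd (measure_eq_zero_iff_ae_notMem.1 h0) h
  · have hc : bondPercolation G p Aᶜ = 0 := (prob_compl_eq_zero_iff hAm).2 h1
    filter_upwards [measure_eq_zero_iff_ae_notMem.1 hc] with ω hω using Set.notMem_compl_iff.1 hω

end Literature.Barriers.CriticalPhenomena

end
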